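import Summits.ABC.IUTFork.Conditional.AbcOfSHwBadMShallowReyssatUniform
import Literature.IUT.HodgeTheaters.InitialThetaDataRootsOfUnityProofs
import HarnessLib

/-!
# Branch C / R-W, M line — ROW «W:M-SHALLOW-REYSSAT-17-19», last piece: the Reyssat datum `λ = 2/23⁵` at its own excluded prime `l = 109`, and the
# uniform M-shallowness statement for EVERY prime `l ≤ 19` and EVERY prime `l ≥ 85` WITHOUT exception (all 15 tabulated Reyssat M rows)

PROOF-ONLY file (no `def`, no new `Prop`, no instance, no notation; nothing re-typed) of the abc-iut cell (D-0079 R-W numerics crew seat abc-iut-W-num-4,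
gen 4; abc-iut-plan RULING C-R73 (2)). Sequel of this seat's `AbcOfSHwBadMShallowReyssatUniform` (p486366), whose `ReyssatM.not_exists_deep` carries
`l ≠ 109` because the lower local type over `109` was taken from the `p ≠ l` pole lemmas. Over `p = l` the genuine tower has the CYCLOTOMIC lower type
instead: `μ_l ⊂ K = F(E_F[l])`, so `(l − 1) ∣ e(w | l)` at every place `w` of `K` over `l` (abc-iut-s2-p4's `InitialThetaData.sub_one_dvd_ramificationIdx`).
* §1 **`GenuineM.sub_one_dvd_absRamificationIdx_kOfM_self`** — `(l − 1) ∣ e(K_{v̲(x₀)}/ℚ_l)` at EVERY M-line member over `p_u = l`, ANY base point.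
* §2 **`ReyssatM.not_exists_deep_hundredNine`** (`l = 109`: over `3`/`23` as in p486366 — `327 ∣ e`, `654 ∣ e ≥ 506`; over `109`: `108 ∣ e`, so
  `d + a + b ≥ 2 − 1/108` against the need `53/109 − 1/55`) and **`ReyssatM.not_exists_deep'`** (`l ≤ 19 ∨ 85 ≤ l`, no other clause) — the member type
  of the `hshallow` binder of abc-iut-C-cert-3's M apex socket `not_hSHwBad_M_of_refuted` (p468391 §1) at `(ratPoint (2/23⁵), l)` VERBATIM. With p486366
  this covers ALL 15 Reyssat M rows of abc-iut-rw-num-lead's M-SHALLOW-INPUTS.tsv (45a0a9129e6618d8): `l ∈ {13, 17, 19, 89, 97, 101, 103, 107, 109, 113,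
  127, 131, 137, 139, 149}`. Nothing is claimed for the primes `29 ≤ l ≤ 83` (see p486366's header: the top label over `23` would be M-deep at `e = 6l`).
HONEST FRAMING: statements about OUR sharp M setting's explicit `(d, a, b)` depth form at one rational datum; «refuted as typed» ≠ «refuted in print»;
nothing here asserts that abc is proved or refuted, or that [IUTchIII] Cor. 3.12 / Thm. 3.11 or [IUTchIV] Thm. 1.10 holds or fails; typed ≠ proved;
instantiated ≠ endorsed; NO abc claim. [claim: Mochizuki2012, status: disputed] for every IUT sentence quoted. [cite: Mochizuki2012, IUTchI Def. 3.1 (c)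
p. 62, Ex. 3.2 (iv) p. 71; IUTchIII Cor. 3.12 Step (xi-f) p. 184; IUTchIV Prop. 1.2 (i)(ii) p. 10, Cor. 2.2 (ii) proof (P5) p. 46] [cite: Washington1997,
Lemma 1.4 and Prop. 2.1] [cite: SerreLocalFields1979, Ch. III §6 Prop. 13] [cite: DupuyHilado2025, §3.3, §3.4]
-/

noncomputable section

open Set Function NumberField IsDedekindDomain

namespace Summit.ABC.IUTFork.Conditional

open Thm311 Thm311.Real Cor312 Cor312Vol Cor312Prov Literature.IUT.LogThetaLattice Literature.IUT.LogVolume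
  Literature.IUT.HodgeTheaters Literature.IUT.LogVolume.ThetaData Literature.IUT.LogVolume.Cor22
open Literature.NumberTheory.NumberFields Literature.NumberTheory.GaloisRepresentations.Ultrametric
open Literature.NumberTheory.DiophantineGeometry Literature.NumberTheory.DiophantineGeometry.GenEll Summit.ABC.ABC.Theorems
open scoped Classical

/-! ## §1. The cyclotomic lower local type over `p = l` at the M-line members: `(l − 1) ∣ e(K_{v̲(x₀)}/ℚ_l)` -/

/-- **`(l − 1) ∣ e(K_{v̲(x₀)}/ℚ_l)` at EVERY M-line member `x₀ ∈ V̲_u` over the datum's own prime `p_u = l`**, for ANY genuine Θ-volume datum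
(any base point): `μ_l ⊂ K = F(E_F[l])` (Weil pairing; abc-iut-s2-p4's `InitialThetaData.sub_one_dvd_ramificationIdx`) read at the M-line place
`placeOfM T.D u x₀` through `absRamificationIdx_rescaledCompletion`. M twin of abc-iut-W-ref-2's `GenuineK.sub_one_dvd_absRamificationIdx_kOf`-family.
[cite: Washington1997, Lemma 1.4 and Prop. 2.1] [cite: Mochizuki2012, IUTchI Def. 3.1 (c) p. 62] [claim: Mochizuki2012, status: disputed] -/
theorem GenuineM.sub_one_dvd_absRamificationIdx_kOfM_self {P : NFPoint} {l : ℕ} (T : Cor22.ThetaVolumeDatumAt P l)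
    (u : FinitePlace ℚ) (hu : ratChar u = l) :
    letI := T.instFieldF; letI := T.instNumberFieldF; letI := T.instAlgebraF; letI := T.instFieldK
    letI := T.instNumberFieldK; letI := T.instAlgebraK; letI := T.instFieldFbar; letI := T.instAlgebraFbar
    letI := T.instAlgebraKFbar; letI := T.instIsElliptic
    ∀ x₀ : (thetaIndexOfInitial T.D).Fibre (Val.non u),
      (l - 1) ∣ absRamificationIdx (ratChar u) (kOfM T.D (ratChar u) u (natCast_ratChar_mem u) x₀) := by
  letI := T.instFieldF; letI := T.instNumberFieldF; letI := T.instAlgebraF; letI := T.instFieldK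
  letI := T.instNumberFieldK; letI := T.instAlgebraK; letI := T.instFieldFbar; letI := T.instAlgebraFbar
  letI := T.instAlgebraKFbar; letI := T.instIsElliptic
  intro x₀
  set w := placeOfM T.D u x₀ with hwdef
  have hpw : ((ratChar u : ℕ) : 𝓞 T.K) ∈ w.asIdeal := natCast_mem_placeOfM T.D (ratChar u) u (natCast_ratChar_mem u) x₀
  have heK : absRamificationIdx (ratChar u) (kOfM T.D (ratChar u) u (natCast_ratChar_mem u) x₀) = w.asIdeal.ramificationIdx ℤ :=
    absRamificationIdx_rescaledCompletion T.K (ratChar u) w hpw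
  rw [heK]
  rw [hu] at hpw
  exact T.D.sub_one_dvd_ramificationIdx w hpw

/-! ## §2. The Reyssat datum at its excluded prime `l = 109`, and the hypothesis-`109`-free uniform statement -/

/-- **M-SHALLOWNESS AT THE REYSSAT DATUM, `l = 109`** (the one tabulated Reyssat M row this seat's `ReyssatM.not_exists_deep`, p486366, excludes):
over `3` and `23` exactly as there (`3l ∣ e`, `6l ∣ e`, `6·109 ≥ 506`); over `109 = l` the cyclotomic bound `108 ∣ e` (§1) gives `d + a + b ≥ 2 − 1/108`
(`ReyssatM.depthConstants_ge`, `k = 1`: `109·108 ≤ 109·e`) against the endpoint need `53/109 − 1/55`. [cite: Mochizuki2012, IUTchI Ex. 3.2 (iv) p. 71,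
Def. 3.1 (c) p. 62; IUTchIV Prop. 1.2 (i)(ii) p. 10, Cor. 2.2 (ii) proof (P5) p. 46] [cite: Washington1997, Prop. 2.1] [claim: Mochizuki2012, status: disputed] -/
theorem ReyssatM.not_exists_deep_hundredNine (T : Cor22.ThetaVolumeDatumAt (ratPoint (((2 : ℕ) : ℚ) / (23 ^ 5 : ℕ))) 109) :
    letI := T.instFieldF; letI := T.instNumberFieldF; letI := T.instAlgebraF; letI := T.instFieldK
    letI := T.instNumberFieldK; letI := T.instAlgebraK; letI := T.instFieldFbar; letI := T.instAlgebraFbar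
    letI := T.instAlgebraKFbar; letI := T.instIsElliptic
    ¬ (∃ (u : FinitePlace ℚ) (i : Fin (thetaIndexOfInitial T.D).lstar) (x₀ : (thetaIndexOfInitial T.D).Fibre (Val.non u)),
      ((ratChar u : ℕ) : ℝ) ^ ((((i : ℕ) : ℝ) + 2) *
      (differentOrd (ratChar u) (kOfM T.D (ratChar u) u (natCast_ratChar_mem u) x₀)
      + logRadiusA (ratChar u) (absRamificationIdx (ratChar u) (kOfM T.D (ratChar u) u (natCast_ratChar_mem u) x₀))
      + logRadiusB (ratChar u) (absRamificationIdx (ratChar u) (kOfM T.D (ratChar u) u (natCast_ratChar_mem u) x₀))) + 1) *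
      ‖tqM T.D (ratChar u) u (natCast_ratChar_mem u) (ideleDataOf T.D T.isVolumeInputOf) x₀‖ ^ (((i : ℕ) + 1) ^ 2 - 1) < 1) := by
  letI := T.instFieldF; letI := T.instNumberFieldF; letI := T.instAlgebraF; letI := T.instFieldK
  letI := T.instNumberFieldK; letI := T.instAlgebraK; letI := T.instFieldFbar; letI := T.instAlgebraFbar
  letI := T.instAlgebraKFbar; letI := T.instIsElliptic
  rintro ⟨u, i, x₀, hlt⟩
  haveI hpfact : Fact (ratChar u).Prime := inferInstance
  have hp1 : (1 : ℝ) < ((ratChar u : ℕ) : ℝ) := by exact_mod_cast hpfact.out.one_lt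
  have hp0 : (0 : ℝ) < ((ratChar u : ℕ) : ℝ) := lt_trans zero_lt_one hp1
  set K₀ := kOfM T.D (ratChar u) u (natCast_ratChar_mem u) x₀ with hK₀def
  set e : ℕ := absRamificationIdx (ratChar u) K₀ with hedef
  set X : ℝ := differentOrd (ratChar u) K₀ + logRadiusA (ratChar u) e + logRadiusB (ratChar u) e with hXdef
  have he1 : 1 ≤ e := absRamificationIdx_pos (ratChar u) K₀
  have he0 : (0 : ℝ) < (e : ℝ) := by exact_mod_cast he1
  have hdab : 0 ≤ X := GenuineMShrink2.depthConstants_nonneg (ratChar u) K₀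
  have hlstar : (thetaIndexOfInitial T.D).lstar = (109 - 1) / 2 := rfl
  have hiN : (i : ℕ) ≤ 53 := by have h1 : (i : ℕ) < (thetaIndexOfInitial T.D).lstar := i.2; omega
  have hiNR : ((i : ℕ) : ℝ) ≤ 53 := by exact_mod_cast hiN
  have hi0 : (0 : ℝ) ≤ ((i : ℕ) : ℝ) := Nat.cast_nonneg _
  have hB : ((((i : ℕ) + 1) ^ 2 - 1 : ℕ) : ℝ) = ((i : ℕ) : ℝ) * (((i : ℕ) : ℝ) + 2) := by
    have : 1 ≤ ((i : ℕ) + 1) ^ 2 := Nat.one_le_pow _ _ (by omega)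
    push_cast [Nat.cast_sub this]
    ring
  by_cases hS : placeModOfM T.D u x₀ ∈ (ThetaData.pilotData T.D).S
  · set v : HeightOneSpectrum (𝓞 ℚ) := finBelow ℚ (fieldOfModuli T.E) (placeModOfM T.D u x₀) with hvdef
    have hgen : Rat.HeightOneSpectrum.natGenerator v = ratChar u :=
      natGenerator_finBelow_placeModOfM T.D (ratChar u) u (natCast_ratChar_mem u) x₀
    have hjF : T.E.j = (((Cor22.jInv (((2 : ℕ) : ℚ) / (23 ^ 5 : ℕ)) : ℚ)) : T.F) := by rw [T.j_eq]; exact eq_ratCast _ _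
    have hnorm := norm_tqM_eq_rpow_ord_rat T.D (ratChar u) u (natCast_ratChar_mem u) (ideleDataOf T.D T.isVolumeInputOf) x₀ hS
      (Cor22.jInv (((2 : ℕ) : ℚ) / (23 ^ 5 : ℕ))) hjF
    have hneg : Literature.IUT.LogVolume.ord ℚ v (Cor22.jInv (((2 : ℕ) : ℚ) / ((23 ^ 5 : ℕ) : ℚ))) < 0 := by
      have h := (ThetaData.pilotData T.D).ord_jE_neg _ hS
      rw [ThetaData.pilotData_jE, jMod_eq_algebraMap_of_j_eq (E := T.E) _ hjF] at h
      exact (Cor22.ord_algebraMap_neg_iff _ _).mp h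
    have hmem : Rat.HeightOneSpectrum.natGenerator v ∈ ({3, 23, 109} : Finset ℕ) := by
      by_contra hnot
      exact absurd (ReyssatM.ord_jInv_nonneg_of_not_mem v hnot) (not_le.mpr hneg)
    have hord := ReyssatM.ord_jInv_of_mem v hmem
    rw [hgen] at hord hmem
    rw [hnorm, ← Real.rpow_natCast, ← Real.rpow_mul hp0.le, ← Real.rpow_add hp0, hB] at hlt
    refine absurd hlt (not_lt.mpr (Real.one_le_rpow hp1.le ?_))
    simp only [Finset.mem_insert, Finset.mem_singleton] at hmem
    rcases hmem with hpu | hpu | hpu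
    · -- over `3`: `3·109 ∣ e`, `X ≥ 5 − 2/327`
      have h3l : 3 * 109 ∣ e := GenuineM.three_mul_prime_dvd_absRamificationIdx_kOfM_ratPoint T u (by rw [hpu]; norm_num) (by rw [hpu]; norm_num)
        (t := 10) (by norm_num) (by norm_num)
        (fun w hw => by rw [ReyssatM.ord_jInv_of_mem w (by rw [hw, hpu]; decide), hw, hpu]; norm_num) x₀
      have hle : 3 * 109 ≤ e := Nat.le_of_dvd he1 h3l
      have hX : (2 : ℝ) + (3 : ℕ) - 2 / ((3 * 109 : ℕ) : ℝ) ≤ X :=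
        ReyssatM.depthConstants_ge_three (ratChar u) K₀ hpu (e₀ := 3 * 109) (k := 3) (by omega) hle (by omega)
      have hordv : ((Literature.IUT.LogVolume.ord ℚ v (Cor22.jInv (((2 : ℕ) : ℚ) / ((23 ^ 5 : ℕ) : ℚ))) : ℤ) : ℝ) = -20 := by
        rw [hord, hpu]; norm_num
      rw [hordv]
      refine ReyssatM.expo_nonneg_div (X := X) (i := ((i : ℕ) : ℝ)) (N := 53) (by norm_num) (by norm_num) hi0 hiNR ?_
      norm_num at hX ⊢; linarith
    · -- over `23`: `6·109 ∣ e ≥ 506`, `X ≥ 3 − 1/654`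
      have h6l := ReyssatM.six_mul_dvd_absRamificationIdx_kOfM_twentyThree T (by norm_num) u hpu x₀
      have hle : 6 * 109 ≤ e := Nat.le_of_dvd he1 h6l
      have hX : (1 : ℝ) + (2 : ℕ) - 1 / ((6 * 109 : ℕ) : ℝ) ≤ X :=
        ReyssatM.depthConstants_ge (ratChar u) K₀ (e₀ := 6 * 109) (k := 2) (by omega) hle (by rw [hpu]; omega)
      have hordv : ((Literature.IUT.LogVolume.ord ℚ v (Cor22.jInv (((2 : ℕ) : ℚ) / ((23 ^ 5 : ℕ) : ℚ))) : ℤ) : ℝ) = -10 := by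
        rw [hord, hpu]; norm_num
      rw [hordv]
      refine ReyssatM.expo_nonneg_div (X := X) (i := ((i : ℕ) : ℝ)) (N := 53) (by norm_num) (by norm_num) hi0 hiNR ?_
      norm_num at hX ⊢; linarith
    · -- over `109 = l`: `108 ∣ e`, `X ≥ 2 − 1/108`
      have h108 : (109 - 1) ∣ e := GenuineM.sub_one_dvd_absRamificationIdx_kOfM_self T u hpu x₀
      have hle : 108 ≤ e := Nat.le_of_dvd he1 (by simpa using h108)
      have hX : (1 : ℝ) + (1 : ℕ) - 1 / ((108 : ℕ) : ℝ) ≤ X :=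
        ReyssatM.depthConstants_ge (ratChar u) K₀ (e₀ := 108) (k := 1) (by omega) hle (by rw [hpu]; omega)
      have hordv : ((Literature.IUT.LogVolume.ord ℚ v (Cor22.jInv (((2 : ℕ) : ℚ) / ((23 ^ 5 : ℕ) : ℚ))) : ℤ) : ℝ) = -2 := by
        rw [hord, hpu]; norm_num
      rw [hordv]
      refine ReyssatM.expo_nonneg_div (X := X) (i := ((i : ℕ) : ℝ)) (N := 53) (by norm_num) (by norm_num) hi0 hiNR ?_
      norm_num at hX ⊢; linarith
  · rw [norm_tqM_eq_one_of_not_mem T.D (ratChar u) u (natCast_ratChar_mem u) (ideleDataOf T.D T.isVolumeInputOf) x₀ hS,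
      one_pow, mul_one] at hlt
    have hi : (0 : ℝ) ≤ ((i : ℕ) : ℝ) + 2 := by positivity
    have hA : 0 ≤ (((i : ℕ) : ℝ) + 2) * X + 1 := by nlinarith [mul_nonneg hi hdab]
    exact absurd hlt (not_lt.mpr (Real.one_le_rpow hp1.le hA))

/-- **UNIFORM M-SHALLOWNESS AT THE REYSSAT DATUM — every prime `l ≤ 19` and every prime `l ≥ 85`, NO exception**: this seat's
`ReyssatM.not_exists_deep` (p486366) with its `l ≠ 109` clause DISCHARGED by `ReyssatM.not_exists_deep_hundredNine`. Covers ALL 15 tabulated Reyssat M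
rows of abc-iut-rw-num-lead's M-SHALLOW-INPUTS.tsv (45a0a9129e6618d8). [cite: Mochizuki2012, IUTchIV Prop. 1.2 (i)(ii) p. 10, Cor. 2.2 (ii) proof (P5) p. 46]
[claim: Mochizuki2012, status: disputed] -/
theorem ReyssatM.not_exists_deep' {l : ℕ} (hl : l ≤ 19 ∨ 85 ≤ l)
    (T : Cor22.ThetaVolumeDatumAt (ratPoint (((2 : ℕ) : ℚ) / (23 ^ 5 : ℕ))) l) :
    letI := T.instFieldF; letI := T.instNumberFieldF; letI := T.instAlgebraF; letI := T.instFieldK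
    letI := T.instNumberFieldK; letI := T.instAlgebraK; letI := T.instFieldFbar; letI := T.instAlgebraFbar
    letI := T.instAlgebraKFbar; letI := T.instIsElliptic
    ¬ (∃ (u : FinitePlace ℚ) (i : Fin (thetaIndexOfInitial T.D).lstar) (x₀ : (thetaIndexOfInitial T.D).Fibre (Val.non u)),
      ((ratChar u : ℕ) : ℝ) ^ ((((i : ℕ) : ℝ) + 2) *
      (differentOrd (ratChar u) (kOfM T.D (ratChar u) u (natCast_ratChar_mem u) x₀)
      + logRadiusA (ratChar u) (absRamificationIdx (ratChar u) (kOfM T.D (ratChar u) u (natCast_ratChar_mem u) x₀))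
      + logRadiusB (ratChar u) (absRamificationIdx (ratChar u) (kOfM T.D (ratChar u) u (natCast_ratChar_mem u) x₀))) + 1) *
      ‖tqM T.D (ratChar u) u (natCast_ratChar_mem u) (ideleDataOf T.D T.isVolumeInputOf) x₀‖ ^ (((i : ℕ) + 1) ^ 2 - 1) < 1) := by
  by_cases h109 : l = 109
  · subst h109
    exact ReyssatM.not_exists_deep_hundredNine T
  · exact ReyssatM.not_exists_deep hl h109 T

end Summit.ABC.IUTFork.Conditional

end
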